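import Summits.Ventures.PercRepro.Night2ThreeFatCount
import Summits.Ventures.PercRepro.Night2TwoFatCells

/-!
# PercRepro — the `(7, 5)` cells `(3, 1)` at `11 ≤ |G| ≤ 15` through THREE fat hyperplanes with pairwise DISJOINT
missed sets (night-2, gen 23)

Three thin members `B₀, B₁, B₂` of a flat `G` whose closures miss `≤ 2` points each and miss pairwise DISJOINT sets give
three rank-`q` sets `H_i = cl B_i ⊇ K`; `card_coverBases_le_cntDisjThree` (`Night2ThreeFatCount`) bounds the covering
bases of a target of size `s` (off the coloops) by `cntDisjThree 5 s = C(s, 5) − 3·C(s − 2, 5) + 3·C(s − 4, 5)`.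
With the chord excess of gen 20 the count sums of `localShadowHall_excess_of_count` are `≥ 1` at every
`n = |G| − 1 ∈ {10, …, 14}` (`1.096 / 1.060 / 1.084 / 1.158 / 1.288`): the cells `(3, 1)` at `|G| = 11, …, 15` close
whenever three fat thin members miss pairwise disjoint sets (`localShadowHall_three_one_five_<N>_of_threeDisjoint`).
The residue statement is `shadowHall_seven_five_of_residuesI` in `Night2ThreeFatCellsB`.
-/

namespace PercRepro.Shadow

open Finset PerFlat ThmH

/-- The count sum of the cell `(3, 1)` at `n = 10` with the three-disjoint-hyperplane count and `E = 71 / 216`: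
`1.096 ≥ 1`. -/
theorem countSum_three_one_ten_d3 :
    1 ≤ countSum 10 5 3 (cPrimeDGP 5 3 5 1 2) (71 / 216 : ℚ) (cntDisjThree 5) := by
  rw [cPrimeDGP_three_one_two]
  unfold countSum DGenP.cjG cntDisjThree
  rw [show Finset.Icc 1 (10 - 5) = {1, 2, 3, 4, 5} by decide]
  repeat rw [Finset.sum_insert (by decide)]
  rw [Finset.sum_singleton]
  norm_num [Nat.choose_eq_descFactorial_div_factorial, Nat.descFactorial, Nat.factorial]

/-- The count sum of the cell `(3, 1)` at `n = 11` with the three-disjoint-hyperplane count and `E = 59 / 200`: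
`1.060 ≥ 1`. -/
theorem countSum_three_one_eleven_d3 :
    1 ≤ countSum 11 5 3 (cPrimeDGP 5 3 5 1 2) (59 / 200 : ℚ) (cntDisjThree 5) := by
  rw [cPrimeDGP_three_one_two]
  unfold countSum DGenP.cjG cntDisjThree
  rw [show Finset.Icc 1 (11 - 5) = {1, 2, 3, 4, 5, 6} by decide]
  repeat rw [Finset.sum_insert (by decide)]
  rw [Finset.sum_singleton]
  norm_num [Nat.choose_eq_descFactorial_div_factorial, Nat.descFactorial, Nat.factorial]

/-- The count sum of the cell `(3, 1)` at `n = 12` with the three-disjoint-hyperplane count and `E = 353 / 1320`: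
`1.084 ≥ 1`. -/
theorem countSum_three_one_twelve_d3 :
    1 ≤ countSum 12 5 3 (cPrimeDGP 5 3 5 1 2) (353 / 1320 : ℚ) (cntDisjThree 5) := by
  rw [cPrimeDGP_three_one_two]
  unfold countSum DGenP.cjG cntDisjThree
  rw [show Finset.Icc 1 (12 - 5) = {1, 2, 3, 4, 5, 6, 7} by decide]
  repeat rw [Finset.sum_insert (by decide)]
  rw [Finset.sum_singleton]
  norm_num [Nat.choose_eq_descFactorial_div_factorial, Nat.descFactorial, Nat.factorial]

/-- The count sum of the cell `(3, 1)` at `n = 13` with the three-disjoint-hyperplane count and `E = 11 / 45`: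
`1.158 ≥ 1`. -/
theorem countSum_three_one_thirteen_d3 :
    1 ≤ countSum 13 5 3 (cPrimeDGP 5 3 5 1 2) (11 / 45 : ℚ) (cntDisjThree 5) := by
  rw [cPrimeDGP_three_one_two]
  unfold countSum DGenP.cjG cntDisjThree
  rw [show Finset.Icc 1 (13 - 5) = {1, 2, 3, 4, 5, 6, 7, 8} by decide]
  repeat rw [Finset.sum_insert (by decide)]
  rw [Finset.sum_singleton]
  norm_num [Nat.choose_eq_descFactorial_div_factorial, Nat.descFactorial, Nat.factorial]

/-- The count sum of the cell `(3, 1)` at `n = 14` with the three-disjoint-hyperplane count and `E = 9 / 40`: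
`1.288 ≥ 1`. -/
theorem countSum_three_one_fourteen_d3 :
    1 ≤ countSum 14 5 3 (cPrimeDGP 5 3 5 1 2) (9 / 40 : ℚ) (cntDisjThree 5) := by
  rw [cPrimeDGP_three_one_two]
  unfold countSum DGenP.cjG cntDisjThree
  rw [show Finset.Icc 1 (14 - 5) = {1, 2, 3, 4, 5, 6, 7, 8, 9} by decide]
  repeat rw [Finset.sum_insert (by decide)]
  rw [Finset.sum_singleton]
  norm_num [Nat.choose_eq_descFactorial_div_factorial, Nat.descFactorial, Nat.factorial]

variable {α : Type*} [DecidableEq α] {M : Matroid α} [M.Finite]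

open scoped Classical in
/-- **The cell `(3, 1)` at `|G| = 11` with three fat thin members missing pairwise DISJOINT sets** (`≤ 2` points each):
(LI_G) through the three-disjoint-hyperplane count of the covering bases. -/
theorem localShadowHall_three_one_five_eleven_of_threeDisjoint {G : Finset α} (hG : G ∈ flatsQ M (5 + 1))
    (hd : (gr M \ G).card = 3) (hk : kColoops M G = 1)
    (hs : ∀ e ∈ gr M, ∀ f ∈ gr M, e ≠ f → rkN M {e, f} = 2) (hl : ∀ e ∈ gr M, M.Indep {e})
    (hn : G.card = 11) {B₀ B₁ B₂ : Finset α} (hB₀ : B₀ ∈ thinMembers M 5 G) (hB₁ : B₁ ∈ thinMembers M 5 G)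
    (hB₂ : B₂ ∈ thinMembers M 5 G)
    (hfat₀ : (G \ clF M B₀).card ≤ 2) (hfat₁ : (G \ clF M B₁).card ≤ 2) (hfat₂ : (G \ clF M B₂).card ≤ 2)
    (hd₀₁ : (G \ clF M B₀) ∩ (G \ clF M B₁) = ∅) (hd₀₂ : (G \ clF M B₀) ∩ (G \ clF M B₂) = ∅)
    (hd₁₂ : (G \ clF M B₁) ∩ (G \ clF M B₂) = ∅) :
    LocalShadowHall M 5 G := by
  have hk' : kColoops M G + 5 = 5 + 1 := by omega
  have hd' : (gr M \ G).card ≤ 5 := by omega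
  have hm2 : ∀ B ∈ thinMembers M 5 G, 5 ≤ (B \ coloops M G).card → 2 ≤ (G \ clF M B).card :=
    fun B hB _ => two_le_card_sdiff_of_not_lay0 hG hd' (mem_thinMembers.1 hB).1 (mem_thinMembers.1 hB).2
  have hc2 : 0 ≤ cPrimeDGP 5 3 5 (kColoops M G) 2 := by
    rw [hk]; unfold cPrimeDGP capDG reqDGP phiQ; norm_num
  have hn' : G.card - kColoops M G = 10 := by omega
  have hKG : coloops M G ⊆ G := fun y hy => (mem_coloops.1 hy).1
  have hnK : (G \ coloops M G).card = 10 := by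
    rw [Finset.card_sdiff_of_subset hKG, ← kColoops_eq_card_coloops]; omega
  refine localShadowHall_excess_of_count (d := 3) (ρ := 5) (m₁ := 2) hG hd (by norm_num) hk' (by norm_num)
    hs hl hc2 hm2 (E := (71 / 216 : ℚ)) (by norm_num) ?_ (cnt := cntDisjThree 5) ?_ ?_ ?_
  · intro S _ T hT
    have hT' : T ∈ (S \ coloops M G).powersetCard 5 := by
      unfold coverBases at hT
      exact (Finset.mem_filter.1 hT).1
    have h := sum_faceLoss_union_le (a := (11 / 45 : ℚ)) (b := (1 / 45 : ℚ)) hG hd (by norm_num) hk' (by omega)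
      hs hl (by norm_num) (by rw [hnK]; intro m h1 h2; exact DGenP.chord_three_one_10 m h1 (by omega))
      (by rw [hnK, hk, DGenP.excessBound_three_one_10]; norm_num) hT'
    rw [hnK, hk, DGenP.excessBound_three_one_10] at h
    exact h
  · intro s h1 h2
    rw [hn'] at h2
    exact cntDisjThree_five_pos s h1 (by omega)
  · intro S hSG
    exact card_coverBases_le_cntDisjThree hk' (by norm_num) (coloops_subset_clF_of_mem_thinMembers hG hd' hB₀)
      (eRk_clF_le_of_mem_thinMembers hB₀) (coloops_subset_clF_of_mem_thinMembers hG hd' hB₁)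
      (eRk_clF_le_of_mem_thinMembers hB₁) (coloops_subset_clF_of_mem_thinMembers hG hd' hB₂)
      (eRk_clF_le_of_mem_thinMembers hB₂) hfat₀ hfat₁ hfat₂ hd₀₁ hd₀₂ hd₁₂ hSG
  · rw [hn', hk]
    exact countSum_three_one_ten_d3

open scoped Classical in
/-- **The cell `(3, 1)` at `|G| = 12` with three fat thin members missing pairwise DISJOINT sets** (`≤ 2` points each):
(LI_G) through the three-disjoint-hyperplane count of the covering bases. -/
theorem localShadowHall_three_one_five_twelve_of_threeDisjoint {G : Finset α} (hG : G ∈ flatsQ M (5 + 1))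
    (hd : (gr M \ G).card = 3) (hk : kColoops M G = 1)
    (hs : ∀ e ∈ gr M, ∀ f ∈ gr M, e ≠ f → rkN M {e, f} = 2) (hl : ∀ e ∈ gr M, M.Indep {e})
    (hn : G.card = 12) {B₀ B₁ B₂ : Finset α} (hB₀ : B₀ ∈ thinMembers M 5 G) (hB₁ : B₁ ∈ thinMembers M 5 G)
    (hB₂ : B₂ ∈ thinMembers M 5 G)
    (hfat₀ : (G \ clF M B₀).card ≤ 2) (hfat₁ : (G \ clF M B₁).card ≤ 2) (hfat₂ : (G \ clF M B₂).card ≤ 2)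
    (hd₀₁ : (G \ clF M B₀) ∩ (G \ clF M B₁) = ∅) (hd₀₂ : (G \ clF M B₀) ∩ (G \ clF M B₂) = ∅)
    (hd₁₂ : (G \ clF M B₁) ∩ (G \ clF M B₂) = ∅) :
    LocalShadowHall M 5 G := by
  have hk' : kColoops M G + 5 = 5 + 1 := by omega
  have hd' : (gr M \ G).card ≤ 5 := by omega
  have hm2 : ∀ B ∈ thinMembers M 5 G, 5 ≤ (B \ coloops M G).card → 2 ≤ (G \ clF M B).card :=
    fun B hB _ => two_le_card_sdiff_of_not_lay0 hG hd' (mem_thinMembers.1 hB).1 (mem_thinMembers.1 hB).2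
  have hc2 : 0 ≤ cPrimeDGP 5 3 5 (kColoops M G) 2 := by
    rw [hk]; unfold cPrimeDGP capDG reqDGP phiQ; norm_num
  have hn' : G.card - kColoops M G = 11 := by omega
  have hKG : coloops M G ⊆ G := fun y hy => (mem_coloops.1 hy).1
  have hnK : (G \ coloops M G).card = 11 := by
    rw [Finset.card_sdiff_of_subset hKG, ← kColoops_eq_card_coloops]; omega
  refine localShadowHall_excess_of_count (d := 3) (ρ := 5) (m₁ := 2) hG hd (by norm_num) hk' (by norm_num)
    hs hl hc2 hm2 (E := (59 / 200 : ℚ)) (by norm_num) ?_ (cnt := cntDisjThree 5) ?_ ?_ ?_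
  · intro S _ T hT
    have hT' : T ∈ (S \ coloops M G).powersetCard 5 := by
      unfold coverBases at hT
      exact (Finset.mem_filter.1 hT).1
    have h := sum_faceLoss_union_le (a := (6 / 25 : ℚ)) (b := (1 / 50 : ℚ)) hG hd (by norm_num) hk' (by omega)
      hs hl (by norm_num) (by rw [hnK]; intro m h1 h2; exact DGenP.chord_three_one_11 m h1 (by omega))
      (by rw [hnK, hk, DGenP.excessBound_three_one_11]; norm_num) hT'
    rw [hnK, hk, DGenP.excessBound_three_one_11] at h
    exact h
  · intro s h1 h2
    rw [hn'] at h2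
    exact cntDisjThree_five_pos s h1 (by omega)
  · intro S hSG
    exact card_coverBases_le_cntDisjThree hk' (by norm_num) (coloops_subset_clF_of_mem_thinMembers hG hd' hB₀)
      (eRk_clF_le_of_mem_thinMembers hB₀) (coloops_subset_clF_of_mem_thinMembers hG hd' hB₁)
      (eRk_clF_le_of_mem_thinMembers hB₁) (coloops_subset_clF_of_mem_thinMembers hG hd' hB₂)
      (eRk_clF_le_of_mem_thinMembers hB₂) hfat₀ hfat₁ hfat₂ hd₀₁ hd₀₂ hd₁₂ hSG
  · rw [hn', hk]
    exact countSum_three_one_eleven_d3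

open scoped Classical in
/-- **The cell `(3, 1)` at `|G| = 13` with three fat thin members missing pairwise DISJOINT sets** (`≤ 2` points each):
(LI_G) through the three-disjoint-hyperplane count of the covering bases. -/
theorem localShadowHall_three_one_five_thirteen_of_threeDisjoint {G : Finset α} (hG : G ∈ flatsQ M (5 + 1))
    (hd : (gr M \ G).card = 3) (hk : kColoops M G = 1)
    (hs : ∀ e ∈ gr M, ∀ f ∈ gr M, e ≠ f → rkN M {e, f} = 2) (hl : ∀ e ∈ gr M, M.Indep {e})
    (hn : G.card = 13) {B₀ B₁ B₂ : Finset α} (hB₀ : B₀ ∈ thinMembers M 5 G) (hB₁ : B₁ ∈ thinMembers M 5 G)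
    (hB₂ : B₂ ∈ thinMembers M 5 G)
    (hfat₀ : (G \ clF M B₀).card ≤ 2) (hfat₁ : (G \ clF M B₁).card ≤ 2) (hfat₂ : (G \ clF M B₂).card ≤ 2)
    (hd₀₁ : (G \ clF M B₀) ∩ (G \ clF M B₁) = ∅) (hd₀₂ : (G \ clF M B₀) ∩ (G \ clF M B₂) = ∅)
    (hd₁₂ : (G \ clF M B₁) ∩ (G \ clF M B₂) = ∅) :
    LocalShadowHall M 5 G := by
  have hk' : kColoops M G + 5 = 5 + 1 := by omega
  have hd' : (gr M \ G).card ≤ 5 := by omega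
  have hm2 : ∀ B ∈ thinMembers M 5 G, 5 ≤ (B \ coloops M G).card → 2 ≤ (G \ clF M B).card :=
    fun B hB _ => two_le_card_sdiff_of_not_lay0 hG hd' (mem_thinMembers.1 hB).1 (mem_thinMembers.1 hB).2
  have hc2 : 0 ≤ cPrimeDGP 5 3 5 (kColoops M G) 2 := by
    rw [hk]; unfold cPrimeDGP capDG reqDGP phiQ; norm_num
  have hn' : G.card - kColoops M G = 12 := by omega
  have hKG : coloops M G ⊆ G := fun y hy => (mem_coloops.1 hy).1
  have hnK : (G \ coloops M G).card = 12 := by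
    rw [Finset.card_sdiff_of_subset hKG, ← kColoops_eq_card_coloops]; omega
  refine localShadowHall_excess_of_count (d := 3) (ρ := 5) (m₁ := 2) hG hd (by norm_num) hk' (by norm_num)
    hs hl hc2 hm2 (E := (353 / 1320 : ℚ)) (by norm_num) ?_ (cnt := cntDisjThree 5) ?_ ?_ ?_
  · intro S _ T hT
    have hT' : T ∈ (S \ coloops M G).powersetCard 5 := by
      unfold coverBases at hT
      exact (Finset.mem_filter.1 hT).1
    have h := sum_faceLoss_union_le (a := (13 / 55 : ℚ)) (b := (1 / 55 : ℚ)) hG hd (by norm_num) hk' (by omega)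
      hs hl (by norm_num) (by rw [hnK]; intro m h1 h2; exact DGenP.chord_three_one_12 m h1 (by omega))
      (by rw [hnK, hk, DGenP.excessBound_three_one_12]; norm_num) hT'
    rw [hnK, hk, DGenP.excessBound_three_one_12] at h
    exact h
  · intro s h1 h2
    rw [hn'] at h2
    exact cntDisjThree_five_pos s h1 (by omega)
  · intro S hSG
    exact card_coverBases_le_cntDisjThree hk' (by norm_num) (coloops_subset_clF_of_mem_thinMembers hG hd' hB₀)
      (eRk_clF_le_of_mem_thinMembers hB₀) (coloops_subset_clF_of_mem_thinMembers hG hd' hB₁)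
      (eRk_clF_le_of_mem_thinMembers hB₁) (coloops_subset_clF_of_mem_thinMembers hG hd' hB₂)
      (eRk_clF_le_of_mem_thinMembers hB₂) hfat₀ hfat₁ hfat₂ hd₀₁ hd₀₂ hd₁₂ hSG
  · rw [hn', hk]
    exact countSum_three_one_twelve_d3

open scoped Classical in
/-- **The cell `(3, 1)` at `|G| = 14` with three fat thin members missing pairwise DISJOINT sets** (`≤ 2` points each):
(LI_G) through the three-disjoint-hyperplane count of the covering bases. -/
theorem localShadowHall_three_one_five_fourteen_of_threeDisjoint {G : Finset α} (hG : G ∈ flatsQ M (5 + 1))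
    (hd : (gr M \ G).card = 3) (hk : kColoops M G = 1)
    (hs : ∀ e ∈ gr M, ∀ f ∈ gr M, e ≠ f → rkN M {e, f} = 2) (hl : ∀ e ∈ gr M, M.Indep {e})
    (hn : G.card = 14) {B₀ B₁ B₂ : Finset α} (hB₀ : B₀ ∈ thinMembers M 5 G) (hB₁ : B₁ ∈ thinMembers M 5 G)
    (hB₂ : B₂ ∈ thinMembers M 5 G)
    (hfat₀ : (G \ clF M B₀).card ≤ 2) (hfat₁ : (G \ clF M B₁).card ≤ 2) (hfat₂ : (G \ clF M B₂).card ≤ 2)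
    (hd₀₁ : (G \ clF M B₀) ∩ (G \ clF M B₁) = ∅) (hd₀₂ : (G \ clF M B₀) ∩ (G \ clF M B₂) = ∅)
    (hd₁₂ : (G \ clF M B₁) ∩ (G \ clF M B₂) = ∅) :
    LocalShadowHall M 5 G := by
  have hk' : kColoops M G + 5 = 5 + 1 := by omega
  have hd' : (gr M \ G).card ≤ 5 := by omega
  have hm2 : ∀ B ∈ thinMembers M 5 G, 5 ≤ (B \ coloops M G).card → 2 ≤ (G \ clF M B).card :=
    fun B hB _ => two_le_card_sdiff_of_not_lay0 hG hd' (mem_thinMembers.1 hB).1 (mem_thinMembers.1 hB).2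
  have hc2 : 0 ≤ cPrimeDGP 5 3 5 (kColoops M G) 2 := by
    rw [hk]; unfold cPrimeDGP capDG reqDGP phiQ; norm_num
  have hn' : G.card - kColoops M G = 13 := by omega
  have hKG : coloops M G ⊆ G := fun y hy => (mem_coloops.1 hy).1
  have hnK : (G \ coloops M G).card = 13 := by
    rw [Finset.card_sdiff_of_subset hKG, ← kColoops_eq_card_coloops]; omega
  refine localShadowHall_excess_of_count (d := 3) (ρ := 5) (m₁ := 2) hG hd (by norm_num) hk' (by norm_num)
    hs hl hc2 hm2 (E := (11 / 45 : ℚ)) (by norm_num) ?_ (cnt := cntDisjThree 5) ?_ ?_ ?_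
  · intro S _ T hT
    have hT' : T ∈ (S \ coloops M G).powersetCard 5 := by
      unfold coverBases at hT
      exact (Finset.mem_filter.1 hT).1
    have h := sum_faceLoss_union_le (a := (7 / 30 : ℚ)) (b := (1 / 60 : ℚ)) hG hd (by norm_num) hk' (by omega)
      hs hl (by norm_num) (by rw [hnK]; intro m h1 h2; exact DGenP.chord_three_one_13 m h1 (by omega))
      (by rw [hnK, hk, DGenP.excessBound_three_one_13]; norm_num) hT'
    rw [hnK, hk, DGenP.excessBound_three_one_13] at h
    exact h
  · intro s h1 h2
    rw [hn'] at h2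
    exact cntDisjThree_five_pos s h1 (by omega)
  · intro S hSG
    exact card_coverBases_le_cntDisjThree hk' (by norm_num) (coloops_subset_clF_of_mem_thinMembers hG hd' hB₀)
      (eRk_clF_le_of_mem_thinMembers hB₀) (coloops_subset_clF_of_mem_thinMembers hG hd' hB₁)
      (eRk_clF_le_of_mem_thinMembers hB₁) (coloops_subset_clF_of_mem_thinMembers hG hd' hB₂)
      (eRk_clF_le_of_mem_thinMembers hB₂) hfat₀ hfat₁ hfat₂ hd₀₁ hd₀₂ hd₁₂ hSG
  · rw [hn', hk]
    exact countSum_three_one_thirteen_d3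

open scoped Classical in
/-- **The cell `(3, 1)` at `|G| = 15` with three fat thin members missing pairwise DISJOINT sets** (`≤ 2` points each):
(LI_G) through the three-disjoint-hyperplane count of the covering bases. -/
theorem localShadowHall_three_one_five_fifteen_of_threeDisjoint {G : Finset α} (hG : G ∈ flatsQ M (5 + 1))
    (hd : (gr M \ G).card = 3) (hk : kColoops M G = 1)
    (hs : ∀ e ∈ gr M, ∀ f ∈ gr M, e ≠ f → rkN M {e, f} = 2) (hl : ∀ e ∈ gr M, M.Indep {e})
    (hn : G.card = 15) {B₀ B₁ B₂ : Finset α} (hB₀ : B₀ ∈ thinMembers M 5 G) (hB₁ : B₁ ∈ thinMembers M 5 G)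
    (hB₂ : B₂ ∈ thinMembers M 5 G)
    (hfat₀ : (G \ clF M B₀).card ≤ 2) (hfat₁ : (G \ clF M B₁).card ≤ 2) (hfat₂ : (G \ clF M B₂).card ≤ 2)
    (hd₀₁ : (G \ clF M B₀) ∩ (G \ clF M B₁) = ∅) (hd₀₂ : (G \ clF M B₀) ∩ (G \ clF M B₂) = ∅)
    (hd₁₂ : (G \ clF M B₁) ∩ (G \ clF M B₂) = ∅) :
    LocalShadowHall M 5 G := by
  have hk' : kColoops M G + 5 = 5 + 1 := by omega
  have hd' : (gr M \ G).card ≤ 5 := by omega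
  have hm2 : ∀ B ∈ thinMembers M 5 G, 5 ≤ (B \ coloops M G).card → 2 ≤ (G \ clF M B).card :=
    fun B hB _ => two_le_card_sdiff_of_not_lay0 hG hd' (mem_thinMembers.1 hB).1 (mem_thinMembers.1 hB).2
  have hc2 : 0 ≤ cPrimeDGP 5 3 5 (kColoops M G) 2 := by
    rw [hk]; unfold cPrimeDGP capDG reqDGP phiQ; norm_num
  have hn' : G.card - kColoops M G = 14 := by omega
  have hKG : coloops M G ⊆ G := fun y hy => (mem_coloops.1 hy).1
  have hnK : (G \ coloops M G).card = 14 := by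
    rw [Finset.card_sdiff_of_subset hKG, ← kColoops_eq_card_coloops]; omega
  refine localShadowHall_excess_of_count (d := 3) (ρ := 5) (m₁ := 2) hG hd (by norm_num) hk' (by norm_num)
    hs hl hc2 hm2 (E := (9 / 40 : ℚ)) (by norm_num) ?_ (cnt := cntDisjThree 5) ?_ ?_ ?_
  · intro S _ T hT
    have hT' : T ∈ (S \ coloops M G).powersetCard 5 := by
      unfold coverBases at hT
      exact (Finset.mem_filter.1 hT).1
    have h := sum_faceLoss_union_le (a := (3 / 13 : ℚ)) (b := (1 / 65 : ℚ)) hG hd (by norm_num) hk' (by omega)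
      hs hl (by norm_num) (by rw [hnK]; intro m h1 h2; exact DGenP.chord_three_one_14 m h1 (by omega))
      (by rw [hnK, hk, DGenP.excessBound_three_one_14]; norm_num) hT'
    rw [hnK, hk, DGenP.excessBound_three_one_14] at h
    exact h
  · intro s h1 h2
    rw [hn'] at h2
    exact cntDisjThree_five_pos s h1 (by omega)
  · intro S hSG
    exact card_coverBases_le_cntDisjThree hk' (by norm_num) (coloops_subset_clF_of_mem_thinMembers hG hd' hB₀)
      (eRk_clF_le_of_mem_thinMembers hB₀) (coloops_subset_clF_of_mem_thinMembers hG hd' hB₁)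
      (eRk_clF_le_of_mem_thinMembers hB₁) (coloops_subset_clF_of_mem_thinMembers hG hd' hB₂)
      (eRk_clF_le_of_mem_thinMembers hB₂) hfat₀ hfat₁ hfat₂ hd₀₁ hd₀₂ hd₁₂ hSG
  · rw [hn', hk]
    exact countSum_three_one_fourteen_d3

end PercRepro.Shadow
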